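import Summits.QuantumFields.YangMills.Theorems.LuscherReductionDressedRitzPolyakovLiftDefs
import Summits.QuantumFields.YangMills.Theorems.LuscherReductionOneSiteLevelsClosed
import Summits.QuantumFields.YangMills.Theorems.LuscherReductionOneSiteLevelsVariational
import Summits.QuantumFields.YangMills.Theorems.LuscherReductionRunningReductionKTPhysSpace
import HarnessLib

/-!
# Route `LuscherReduction`, crux `DressedRitz` (stmt-QuantumFields-20205), line «polyakovlift» — NEGATIVE lane:
# what the `∀`-basis leakage clause (o4) forbids, and why the closed crux ONE discharges the inter-shell case

Negative-side support lemmas of the standing disprover (seat `ym-cdisprove-20205-1` g0; work file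
`Cruxes/DressedRitz/Disproof.lean`).  Nothing here asserts a route item; nothing here refutes one.  The stubs
`stub_liftStatics` ∕ `stub_liftLeakage` of the line quantify their clause groups over EVERY one-site eigen-ratio basis
(`PolyakovLift.LiftBasis`), hence over all rotations inside every exactly degenerate one-site multiplet at the lift
coupling `B₁ = 2/Λ³`; the lift `g ↦ liftVec β φ g` is linear, so a rotated basis lifts to the rotated family.

* §1 MIXTURE ALGEBRA (exact model of the hazard): for two `l2`-orthonormal physical exact eigenvectors `ψ₁, ψ₂` of
  `K_β` with eigenvalues `κ₁, κ₂`, the equal mixture `u = ψ₁ + ψ₂` has `‖u‖² = 2`, `⟨u,Ku⟩ = κ₁+κ₂`, `‖Ku‖² = κ₁²+κ₂²`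
  and LEAKAGE DEFECT `‖Ku‖²‖u‖² − ⟨u,Ku⟩² = (κ₁ − κ₂)²` (`leakage_defect_of_mixture`); consequently
  `¬ LeakageClause 1 C β (fun _ ↦ ψ₁ + ψ₂)` whenever `(κ₁−κ₂)² > 4C(Λ³/L²)λ₀²` (`not_leakageClause_of_mixture`): the
  single-state-dominance clause tolerates splittings `≤ 2√C Λ^{3/2}λ₀/L` only, far below the inter-shell spacing
  `≍ (Λ/L)λ₀` — an exact one-site crossing at `B₁` between levels lifting into different fine shells would falsify the
  `∀`-basis S-LEAK.
* §2 NO INTER-SHELL CROSSINGS AT LARGE COUPLING, from the CLOSED crux ONE (`oneSiteLevels_proof`): distinct `𝔥`-gaps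
  `levelGap a < levelGap b` ⇒ `μ_b(B) < μ_a(B)` for all `B ≥ B₀` (`oneSite_levelValue_lt_of_levelGap_lt`), in particular
  at `B₁ = liftCoupling β L` once `B₁ ≥ B₀` (`oneSite_levels_ne_at_liftCoupling`) — the labelling `σ` of a lift basis can
  never rotate two such levels into each other deep in the femto window.  What remains are same-gap (fine-structure)
  crossings, whose lifted defect is `O(Λ⁴/L²)λ₀²`, inside (o4).
* §3 DICTIONARY of the line's two couplings: `liftCoupling = oneSiteCoupling / L³` (`liftCoupling_eq`) and
  `bareLambda (liftCoupling β L) = Λ` (`bareLambda_liftCoupling`; the tree has `bareLambda (oneSiteCoupling β L) = Λ/L`):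
  the basis is read where the one-site scaling variable equals the fine zero-mode scale, the Lüscher position where it
  equals the fine level spacing.

HONEST FRAMING: fixed-lattice linear algebra and a corollary of ONE; no bearing on the truth of the stubs beyond the
hazard bookkeeping above, none on infinite volume, the continuum limit or the Clay mass gap.
References: M. Lüscher, NPB 219 (1983) 233 [cite: Luscher1983, §3]; Lüscher–Wolff, NPB 339 (1990) 222 [cite: LuscherWolff1990].
-/

set_option autoImplicit false

noncomputable section

open MeasureTheory Filter Topology Real
open Literature.MathematicalPhysics.QuantumFieldTheory (GaugeConfig Site gaugeTransform)
open scoped BigOperators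

namespace Summit.QuantumFields.YangMills.Theorems.FemtoTransferGap.PolyakovLift.Negative

open Summit.QuantumFields.YangMills.Theorems.FemtoTransferGap
open Summit.QuantumFields.YangMills.Theorems.FemtoTransferGap.PolyakovLift

/-! ## §1 Mixture algebra: the leakage defect of an equal mixture of two exact eigenvectors -/

/-- `l2` is additive in its second argument on physical test functions. [folklore] -/
theorem l2_add_right {L : ℕ} [NeZero L] {ψ φ φ' : GaugeConfig 3 L SU2 → ℝ} (hψ : IsPhys ψ)
    (hφ : IsPhys φ) (hφ' : IsPhys φ') : l2 ψ (φ + φ') = l2 ψ φ + l2 ψ φ' := by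
  rw [l2_comm, l2_add_left hφ hφ' hψ, l2_comm φ, l2_comm φ']

/-- `l2` is homogeneous in its second argument. [folklore] -/
theorem l2_smul_right'' {L : ℕ} [NeZero L] (a : ℝ) (ψ φ : GaugeConfig 3 L SU2 → ℝ) :
    l2 ψ (a • φ) = a * l2 ψ φ := by
  rw [l2_comm, l2_smul_left, l2_comm]

section Mixture

variable {L : ℕ} [NeZero L] (β : ℝ) {ψ₁ ψ₂ : GaugeConfig 3 L SU2 → ℝ} {κ₁ κ₂ : ℝ}

/-- Norm of the equal mixture of two orthonormal physical vectors: `‖ψ₁ + ψ₂‖² = 2`. [folklore] -/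
theorem l2_mixture_self (h₁ : IsPhys ψ₁) (h₂ : IsPhys ψ₂) (hn₁ : l2 ψ₁ ψ₁ = 1) (hn₂ : l2 ψ₂ ψ₂ = 1)
    (h₁₂ : l2 ψ₁ ψ₂ = 0) : l2 (ψ₁ + ψ₂) (ψ₁ + ψ₂) = 2 := by
  have h₂₁ : l2 ψ₂ ψ₁ = 0 := by rw [l2_comm]; exact h₁₂
  rw [l2_add_left h₁ h₂ (h₁.add h₂), l2_add_right h₁ h₁ h₂, l2_add_right h₂ h₁ h₂, hn₁, hn₂, h₁₂, h₂₁]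
  norm_num

/-- Rayleigh numerator of the mixture of two exact eigenvectors: `⟨u, K u⟩ = κ₁ + κ₂`. [folklore] -/
theorem l2_mixture_transferApply (h₁ : IsPhys ψ₁) (h₂ : IsPhys ψ₂)
    (he₁ : transferApply β ψ₁ = κ₁ • ψ₁) (he₂ : transferApply β ψ₂ = κ₂ • ψ₂)
    (hn₁ : l2 ψ₁ ψ₁ = 1) (hn₂ : l2 ψ₂ ψ₂ = 1) (h₁₂ : l2 ψ₁ ψ₂ = 0) :
    l2 (ψ₁ + ψ₂) (transferApply β (ψ₁ + ψ₂)) = κ₁ + κ₂ := by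
  have h₂₁ : l2 ψ₂ ψ₁ = 0 := by rw [l2_comm]; exact h₁₂
  have hK : transferApply β (ψ₁ + ψ₂) = κ₁ • ψ₁ + κ₂ • ψ₂ := by rw [transferApply_add β h₁ h₂, he₁, he₂]
  have hs₁ : IsPhys (κ₁ • ψ₁) := h₁.smul κ₁
  have hs₂ : IsPhys (κ₂ • ψ₂) := h₂.smul κ₂
  rw [hK, l2_add_left h₁ h₂ (hs₁.add hs₂), l2_add_right h₁ hs₁ hs₂, l2_add_right h₂ hs₁ hs₂,
    l2_smul_right'', l2_smul_right'', l2_smul_right'', l2_smul_right'', hn₁, hn₂, h₁₂, h₂₁]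
  ring

/-- `‖K u‖² = κ₁² + κ₂²` for the mixture. [folklore] -/
theorem l2_transferApply_mixture_self (h₁ : IsPhys ψ₁) (h₂ : IsPhys ψ₂)
    (he₁ : transferApply β ψ₁ = κ₁ • ψ₁) (he₂ : transferApply β ψ₂ = κ₂ • ψ₂)
    (hn₁ : l2 ψ₁ ψ₁ = 1) (hn₂ : l2 ψ₂ ψ₂ = 1) (h₁₂ : l2 ψ₁ ψ₂ = 0) :
    l2 (transferApply β (ψ₁ + ψ₂)) (transferApply β (ψ₁ + ψ₂)) = κ₁ ^ 2 + κ₂ ^ 2 := by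
  have h₂₁ : l2 ψ₂ ψ₁ = 0 := by rw [l2_comm]; exact h₁₂
  have hK : transferApply β (ψ₁ + ψ₂) = κ₁ • ψ₁ + κ₂ • ψ₂ := by rw [transferApply_add β h₁ h₂, he₁, he₂]
  have hs₁ : IsPhys (κ₁ • ψ₁) := h₁.smul κ₁
  have hs₂ : IsPhys (κ₂ • ψ₂) := h₂.smul κ₂
  rw [hK, l2_add_left hs₁ hs₂ (hs₁.add hs₂), l2_add_right hs₁ hs₁ hs₂, l2_add_right hs₂ hs₁ hs₂,
    l2_smul_left, l2_smul_left, l2_smul_left, l2_smul_left,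
    l2_smul_right'', l2_smul_right'', l2_smul_right'', l2_smul_right'', hn₁, hn₂, h₁₂, h₂₁]
  ring

/-- **The leakage defect of an equal mixture of two exact eigenvectors is the squared level splitting**:
`‖Ku‖²‖u‖² − ⟨u,Ku⟩² = (κ₁ − κ₂)²` for `u = ψ₁ + ψ₂`. [folklore] -/
theorem leakage_defect_of_mixture (h₁ : IsPhys ψ₁) (h₂ : IsPhys ψ₂)
    (he₁ : transferApply β ψ₁ = κ₁ • ψ₁) (he₂ : transferApply β ψ₂ = κ₂ • ψ₂)
    (hn₁ : l2 ψ₁ ψ₁ = 1) (hn₂ : l2 ψ₂ ψ₂ = 1) (h₁₂ : l2 ψ₁ ψ₂ = 0) :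
    l2 (transferApply β (ψ₁ + ψ₂)) (transferApply β (ψ₁ + ψ₂)) * l2 (ψ₁ + ψ₂) (ψ₁ + ψ₂)
      - l2 (ψ₁ + ψ₂) (transferApply β (ψ₁ + ψ₂)) ^ 2 = (κ₁ - κ₂) ^ 2 := by
  rw [l2_transferApply_mixture_self β h₁ h₂ he₁ he₂ hn₁ hn₂ h₁₂, l2_mixture_self h₁ h₂ hn₁ hn₂ h₁₂,
    l2_mixture_transferApply β h₁ h₂ he₁ he₂ hn₁ hn₂ h₁₂]
  ring

/-- **What the `∀`-basis leakage clause (o4) forbids.**  For the singleton family `u ≡ ψ₁ + ψ₂` (two orthonormal exact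
eigenvectors of `K_β`), `LeakageClause 1 C β u` FAILS as soon as `(κ₁ − κ₂)² > 4·C(Λ³/L²)λ₀²`, i.e. the splitting exceeds
`2√C·Λ^{3/2}λ₀/L` — far below the inter-shell spacing `≍ (Λ/L)λ₀` of Lüscher's law.  So S-LEAK over EVERY lift basis
asserts in particular that no admissible basis at `B₁` lifts (approximately) to such a mixture. [cite: LuscherWolff1990] -/
theorem not_leakageClause_of_mixture (C : ℝ) (h₁ : IsPhys ψ₁) (h₂ : IsPhys ψ₂)
    (he₁ : transferApply β ψ₁ = κ₁ • ψ₁) (he₂ : transferApply β ψ₂ = κ₂ • ψ₂)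
    (hn₁ : l2 ψ₁ ψ₁ = 1) (hn₂ : l2 ψ₂ ψ₂ = 1) (h₁₂ : l2 ψ₁ ψ₂ = 0)
    (hgap : 4 * (C * (luscherLambda β L ^ 3 / (L : ℝ) ^ 2) * levelValue su2Rep L β 0 ^ 2) < (κ₁ - κ₂) ^ 2) :
    ¬ LeakageClause 1 C β (fun _ => ψ₁ + ψ₂) := by
  intro h
  have h0 := h 0
  dsimp only at h0
  rw [leakage_defect_of_mixture β h₁ h₂ he₁ he₂ hn₁ hn₂ h₁₂, l2_mixture_self h₁ h₂ hn₁ hn₂ h₁₂] at h0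
  linarith

end Mixture

/-! ## §2 No inter-shell crossings of one-site levels at large coupling (corollary of the closed crux ONE) -/

/-- **Distinct `𝔥`-gaps ⇒ eventually strictly ordered one-site levels**: if `levelGap a < levelGap b` then
`μ_b(B) < μ_a(B)` for all `B ≥ B₀` (from the two-sided laws `e^{−(ε_kλ_b ± Cλ_b²)}μ₀` of `oneSiteLevels_proof`, taking
`λ_b(B) = (2/B)^{1/3} < (ε_b − ε_a)/max(C_a+C_b,1)`). [cite: Luscher1983, §3] -/
theorem oneSite_levelValue_lt_of_levelGap_lt {a b : ℕ} (hab : levelGap a < levelGap b) :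
    ∃ B0 : ℝ, ∀ B : ℝ, B0 ≤ B → levelValue su2Rep 1 B b < levelValue su2Rep 1 B a := by
  obtain ⟨Ca, Ba, ha⟩ := oneSiteLevels_proof a
  obtain ⟨Cb, Bb, hb⟩ := oneSiteLevels_proof b
  set δ : ℝ := levelGap b - levelGap a with hδ
  have hδpos : 0 < δ := sub_pos.mpr hab
  set Cs : ℝ := max (Ca + Cb) 1 with hCs
  have hCspos : 0 < Cs := lt_of_lt_of_le one_pos (le_max_right _ _)
  have hdc : 0 < δ / Cs := div_pos hδpos hCspos
  have hpow : 0 < (δ / Cs) ^ 3 := pow_pos hdc 3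
  refine ⟨max (max Ba Bb) (2 / (δ / Cs) ^ 3 + 1), fun B hB => ?_⟩
  have hBa : Ba ≤ B := ((le_max_left _ _).trans (le_max_left _ _)).trans hB
  have hBb : Bb ≤ B := ((le_max_right _ _).trans (le_max_left _ _)).trans hB
  have hBgt : 2 / (δ / Cs) ^ 3 < B := by
    have := (le_max_right (max Ba Bb) (2 / (δ / Cs) ^ 3 + 1)).trans hB
    linarith
  have hBpos : 0 < B := (div_pos two_pos hpow).trans hBgt
  obtain ⟨hμ0, -, hka⟩ := ha B hBa
  obtain ⟨-, hbk, -⟩ := hb B hBb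
  have hlpos : 0 < bareLambda B := by
    unfold bareLambda
    exact Real.rpow_pos_of_pos (div_pos two_pos hBpos) _
  have hllt : bareLambda B < δ / Cs := by
    have h2 : 2 < B * (δ / Cs) ^ 3 := (div_lt_iff₀ hpow).mp hBgt
    have hx : 2 / B < (δ / Cs) ^ 3 := (div_lt_iff₀ hBpos).mpr (by rw [mul_comm]; exact h2)
    have h13 : ((1 : ℝ) / 3) = ((3 : ℕ) : ℝ)⁻¹ := by norm_num
    have hroot : ((δ / Cs) ^ 3) ^ ((1 : ℝ) / 3) = δ / Cs := by
      rw [h13]; exact Real.pow_rpow_inv_natCast hdc.le (by norm_num)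
    unfold bareLambda
    calc (2 / B) ^ ((1 : ℝ) / 3) < ((δ / Cs) ^ 3) ^ ((1 : ℝ) / 3) :=
          Real.rpow_lt_rpow (div_pos two_pos hBpos).le hx (by norm_num)
      _ = δ / Cs := hroot
  have hkey : (Ca + Cb) * bareLambda B < δ := by
    have h1 : (Ca + Cb) * bareLambda B ≤ Cs * bareLambda B :=
      mul_le_mul_of_nonneg_right (le_max_left _ _) hlpos.le
    have h2 : Cs * bareLambda B < Cs * (δ / Cs) := mul_lt_mul_of_pos_left hllt hCspos
    have h3 : Cs * (δ / Cs) = δ := mul_div_cancel₀ δ hCspos.ne'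
    linarith
  have hmain : levelGap a * bareLambda B + Ca * bareLambda B ^ 2 <
      levelGap b * bareLambda B - Cb * bareLambda B ^ 2 := by
    have h := mul_lt_mul_of_pos_right hkey hlpos
    rw [hδ] at h
    nlinarith [h, hlpos]
  calc levelValue su2Rep 1 B b
      ≤ Real.exp (-(levelGap b * bareLambda B - Cb * bareLambda B ^ 2)) * levelValue su2Rep 1 B 0 := hbk
    _ < Real.exp (-(levelGap a * bareLambda B + Ca * bareLambda B ^ 2)) * levelValue su2Rep 1 B 0 :=
        mul_lt_mul_of_pos_right (Real.exp_lt_exp.mpr (by linarith)) hμ0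
    _ ≤ levelValue su2Rep 1 B a := hka

/-- In the line's currency: once `B₁ = liftCoupling β L ≥ B₀`, two one-site levels of different `𝔥`-gap are DISTINCT at
the lift coupling, so no `LiftBasis` labelling/rotation mixes them. [cite: Luscher1983, §3] -/
theorem oneSite_levels_ne_at_liftCoupling {a b : ℕ} (hab : levelGap a < levelGap b) :
    ∃ B0 : ℝ, ∀ (β : ℝ) (L : ℕ), B0 ≤ liftCoupling β L →
      levelValue su2Rep 1 (liftCoupling β L) b ≠ levelValue su2Rep 1 (liftCoupling β L) a := by
  obtain ⟨B0, h⟩ := oneSite_levelValue_lt_of_levelGap_lt hab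
  exact ⟨B0, fun β L hB => (h _ hB).ne⟩

/-! ## §3 Dictionary of the two one-site couplings of the line -/

/-- `B₁ = B/L³`: the lift coupling is the position coupling divided by the volume factor. [cite: Luscher1983, §3] -/
theorem liftCoupling_eq {β : ℝ} {L : ℕ} [NeZero L] :
    liftCoupling β L = oneSiteCoupling β L / (L : ℝ) ^ 3 := by
  have hL : ((L : ℝ) ^ 3) ≠ 0 := pow_ne_zero 3 (Nat.cast_ne_zero.mpr (NeZero.ne L))
  unfold liftCoupling oneSiteCoupling
  rw [div_right_comm, mul_div_cancel_right₀ _ hL]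

/-- `λ_b(B₁) = Λ`: at the lift coupling the one-site scaling variable equals the fine zero-mode scale
(compare the tree's `bareLambda_oneSiteCoupling : λ_b(B) = Λ/L`). [cite: Luscher1983, §3] -/
theorem bareLambda_liftCoupling {β : ℝ} {L : ℕ} (hl : 0 < luscherLambda β L) :
    bareLambda (liftCoupling β L) = luscherLambda β L := by
  have hne : luscherLambda β L ≠ 0 := hl.ne'
  unfold bareLambda liftCoupling
  have hq : (2 : ℝ) / (2 / luscherLambda β L ^ 3) = luscherLambda β L ^ 3 := by
    field_simp
  rw [hq, show ((1 : ℝ) / 3) = ((3 : ℕ) : ℝ)⁻¹ by norm_num]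
  exact Real.pow_rpow_inv_natCast hl.le (by norm_num)

end Summit.QuantumFields.YangMills.Theorems.FemtoTransferGap.PolyakovLift.Negative

end
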